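import Literature.Analysis.FluidPDE.HeatDivTensorL2
import Literature.Analysis.FluidPDE.SolenoidalL2Duality
import Literature.Analysis.FluidPDE.HeatFlowLpClass
import Literature.Analysis.FluidPDE.LerayHopfMild
import Literature.Analysis.FluidPDE.MildL3Restart
import Literature.Analysis.FunctionSpaces.HilbertValuedMeasurability
import HarnessLib

/-!
# Duality form ⇔ `L²` Duhamel formula for mild solutions (Lemarié-Rieusset 2002, Thm. 11.2): the proof

Sibling proof file of `MildSolution.lean` (D-0014: the named fact `def X : Prop` is discharged as
`theorem X_holds : X`). It discharges

* `Literature.Analysis.FluidPDE.isMildNSSolutionOn_iff_duhamel_two_holds :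
  isMildNSSolutionOn_iff_duhamel_two` — for `0 < ν`, `u₀ ∈ L²`, `u` measurable on `(0,T) × E`,
  bounded on `[0,T) × E`, with every slice `u t ∈ L²` (`t ∈ [0,T)`) and `u ∈ L^∞((0,T); L²)`:
  `u` is an (unforced) mild solution on `[0, T)` in the tree's duality ("very weak") form
  (`IsMildNSSolutionOn (Ico 0 T) ν 0 u₀ u`) **iff** for every `t ∈ [0, T)`, in `L²(E; E)`,
  `u(t) = e^{νtΔ} P u₀ - ∫₀ᵗ P e^{ν(t-τ)Δ} div (u ⊗ u)(τ) dτ` (`P` the Leray projector, the time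
  integral a Bochner integral in `L²`).

## Source

P. G. Lemarié-Rieusset, *Recent developments in the Navier–Stokes problem*, Chapman & Hall/CRC
Research Notes in Mathematics 431 (2002), Ch. 11, Thm. 11.2 (bib key `LemarieRieusset2002`; only
the table of contents is held, `lit` key `paper:doi-10-1201-9781420035674`). The same theorem,
rewritten, is Thm. 6.1 ("Oseen's equations") of the second edition, P. G. Lemarié-Rieusset, *The
Navier–Stokes Problem in the 21st Century*, CRC Press 2016 (bib key `LemarieRieusset2016`; read in
full, galaxy `panama:505491880935428`, Ch. 6 "The differential and the integral Navier–Stokes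
equations"): for `ν > 0`, `0 < T < ∞`, `u₀` divergence free, and
`u ∈ L²((0,T), L²((1+|x|)^{-4} dx))`, the differential (Leray-projected, very weak) formulation
`∂ₜu = νΔu + P(f - div(u ⊗ u))`, `u(0) = u₀` is equivalent to the integral formulation
`u = W_{νt} ∗ u₀ + ∫₀ᵗ W_{ν(t-s)} ∗ Pf ds - ∫₀ᵗ Σⱼ ∂ⱼ O(ν(t-s)) :: (uⱼ u) ds`. The tree's fact is
this equivalence restricted to the class `u ∈ L^∞_t L²_x ∩ L^∞_{t,x}`, `f = 0`, with the `L²`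
Leray projector (loc. cit., §6.3: on `L²`, `P` is the orthogonal projection onto `L²_σ`) and the
datum entering through `P u₀`.

## Proof

Fix `t ∈ [0, T)` and a smooth compactly supported divergence-free `φ` (`φ ∈ 𝒱`). Put
`V₀ = [e^{νtΔ} P u₀]`, `N(τ) = [e^{ν(t-τ)Δ} div (u ⊗ u)(τ)] = [heatDivTensor (ν(t-τ)) (u τ) (u τ)]`
(`τ ∈ (0,t)`), `D = ∫₀ᵗ P N(τ) dτ` (Bochner in `L²`).

1. **The Duhamel integrand is Bochner integrable in `L²`** (`intervalIntegrable_lerayProjector_duhamel`):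
   `τ ↦ N(τ)` is a.e. strongly measurable (`aestronglyMeasurable_duhamel_slices`: Pettis' theorem
   in the separable Hilbert space `L²` reduces this to the measurability of
   `τ ↦ ∫ ⟪h, heatDivTensor…⟫`, i.e. to Fubini, once `u` is replaced by a jointly measurable
   version — `HilbertValuedMeasurability`, `HeatDivTensorL2`), and
   `‖N(τ)‖₂ ≤ C 2^{n/2} (ν(t-τ))^{-1/2} ‖u(τ)‖₂ ≤ C' (t-τ)^{-1/2}` for a.e. `τ` (Young,
   `eLpNorm_heatDivTensor_le`, and `u ∈ L^∞_t L²_x`), which is integrable on `(0, t)`.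
2. **Pairings** (`inner_duhamelDatum_eq`, `inner_intervalIntegral_lerayProjector_eq`):
   `⟪V₀, [φ]⟫ = ∫⟪u₀, e^{νtΔ}φ⟫` (symmetry of the heat semigroup, self-adjointness of `P`,
   `P e^{νtΔ}φ = e^{νtΔ}φ` because `e^{νtΔ}φ` is weakly divergence free and `L²_σ` is the space of
   weakly divergence-free `L²` fields, `mem_solenoidalL2_iff_holds`), and
   `⟪D, [φ]⟫ = ∫₀ᵗ ⟪N(τ), [φ]⟫ = -∫₀ᵗ ∫ ⟪u, (u·∇) e^{ν(t-τ)Δ}φ⟫` (the continuous linear functional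
   `⟪·, [φ]⟫` passes through the Bochner integral by Step 1; the pairing identity
   `integral_inner_heatDivTensor_eq`). Hence `⟪V₀ - D, [φ]⟫` is exactly the right-hand side of
   the duality identity, and `V₀ - D ∈ L²_σ`.
3. (⇐) Pair the Duhamel formula with `[φ]`: the duality identity; `[u t] = V₀ - D ∈ L²_σ` is
   weakly divergence free. (⇒) `w = [u t] - (V₀ - D) ∈ L²_σ` annihilates `𝒱`, hence vanishes
   (`IsWeaklyDivFree.ae_eq_zero_of_memLp_of_forall_integral_inner_eq_zero`). The data `(v₀, N)`
   of the right-hand side are rigid (`v₀ = V₀`, `N = N(·)` on `(0,t)`), so the given Duhamel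
   formula is the canonical one.

## References

* P. G. Lemarié-Rieusset, *Recent developments in the Navier–Stokes problem*, CRC 2002, Ch. 11,
  Thm. 11.2. [LemarieRieusset2002]
* P. G. Lemarié-Rieusset, *The Navier–Stokes Problem in the 21st Century*, CRC 2016, Ch. 6,
  Thm. 6.1, §6.3. [LemarieRieusset2016]
* E. B. Fabes, B. F. Jones, N. M. Rivière, Arch. Rational Mech. Anal. 45 (1972), Thm. 2.1.
* T. Kato, Math. Z. 187 (1984) 471–480, (1.7).
* B. J. Pettis, Trans. Amer. Math. Soc. 44 (1938), Thm. 1.1. [Pettis1938]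
-/

noncomputable section

open MeasureTheory TopologicalSpace Set Function Filter Topology InnerProductSpace
open scoped RealInnerProductSpace ENNReal NNReal Interval

namespace Literature.Analysis.FluidPDE

variable {E : Type*} [NormedAddCommGroup E] [InnerProductSpace ℝ E] [FiniteDimensional ℝ E]
  [MeasurableSpace E] [BorelSpace E]

/-! ### Pairings of `L²` classes with divergence-free test fields -/

/-- `⟪[f], [φ]⟫ = ∫ ⟪f, φ⟫` for `f ∈ L²` and `φ ∈ 𝒱`. [folklore] -/
theorem inner_toLp_divFreeTestToL2 {f : E → E} (hf : MemLp f 2 volume) (φ : divFreeTest E) :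
    ⟪hf.toLp f, divFreeTestToL2 E φ⟫ = ∫ x, ⟪f x, (φ : E → E) x⟫ := by
  rw [inner_divFreeTestToL2]
  refine integral_congr_ae ?_
  filter_upwards [hf.coeFn_toLp] with x hx
  rw [hx]

/-- `⟪[φ], v⟫ = ∫ ⟪φ, v⟫` for `v ∈ L²` and `φ ∈ 𝒱`. [folklore] -/
theorem inner_divFreeTestToL2_left (φ : divFreeTest E) (v : Lp E 2 (volume : Measure E)) :
    ⟪divFreeTestToL2 E φ, v⟫ = ∫ x, ⟪(φ : E → E) x, (v : E → E) x⟫ := by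
  rw [L2.inner_def]
  refine integral_congr_ae ?_
  filter_upwards [coeFn_divFreeTestToL2 φ] with x hx
  rw [hx]

/-- **Symmetry of the heat flow pairing for all times**: `∫⟪e^{sΔ}f, g⟫ = ∫⟪f, e^{sΔ}g⟫` for
`f, g ∈ L²` and every real `s` (`s ≤ 0`: the flow is the identity; `s > 0`: the tree's
`integral_inner_heatExtension_comm`). [folklore] -/
theorem integral_inner_heatFlow_comm {f g : E → E} (hf : MemLp f 2 volume) (hg : MemLp g 2 volume)
    (s : ℝ) : ∫ x, ⟪heatFlow f s x, g x⟫ = ∫ x, ⟪f x, heatFlow g s x⟫ := by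
  rcases le_or_gt s 0 with hs | hs
  · rw [heatFlow_of_nonpos f hs, heatFlow_of_nonpos g hs]
  · rw [heatFlow_of_pos f hs, heatFlow_of_pos g hs]
    exact (integral_inner_heatExtension_comm hf hg hs).symm

/-- The `L²` class of the caloric test field `e^{ντΔ}φ` of `φ ∈ 𝒱` lies in `L²_σ` (it is weakly
divergence free, and `L²_σ` is the space of weakly divergence-free `L²` fields,
`mem_solenoidalL2_iff_holds`). [folklore] -/
theorem toLp_heatTest_mem_solenoidalL2 (φ : divFreeTest E) (ν τ : ℝ) :
    (memLp_heatTest φ.2.1 ν τ).toLp (heatTest ν (φ : E → E) τ) ∈ solenoidalL2 E := by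
  refine (mem_solenoidalL2_iff_holds _).2 ?_
  exact (isWeaklyDivFree_heatTest φ.2.1 φ.2.2 ν τ).congr_ae (MemLp.coeFn_toLp _).symm

/-- **The Leray projector fixes caloric test fields**: `⟪P v, [e^{ντΔ}φ]⟫ = ⟪v, [e^{ντΔ}φ]⟫`, i.e.
`P e^{ντΔ}φ = e^{ντΔ}φ` in `L²` (self-adjointness of `P` and `e^{ντΔ}φ ∈ L²_σ`). [folklore] -/
theorem inner_lerayProjector_toLp_heatTest (v : Lp E 2 (volume : Measure E)) (φ : divFreeTest E)
    (ν τ : ℝ) :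
    ⟪lerayProjector E v, (memLp_heatTest φ.2.1 ν τ).toLp (heatTest ν (φ : E → E) τ)⟫ =
      ⟪v, (memLp_heatTest φ.2.1 ν τ).toLp (heatTest ν (φ : E → E) τ)⟫ := by
  change ⟪(solenoidalL2 E).starProjection v, _⟫ = _
  rw [Submodule.inner_starProjection_left_eq_right]
  change ⟪v, lerayProjector E _⟫ = _
  rw [lerayProjector_apply_of_mem (toLp_heatTest_mem_solenoidalL2 φ ν τ)]

/-- **The datum pairing** `⟪[e^{νtΔ} P u₀], [φ]⟫ = ∫ ⟪u₀, e^{νtΔ}φ⟫` for `u₀ ∈ L²`, `φ ∈ 𝒱` and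
`ν t` real (heat symmetry, self-adjointness of `P`, `P e^{νtΔ}φ = e^{νtΔ}φ`; Lemarié-Rieusset 2016,
Thm. 6.1; Kato 1984, (1.7) tested). [cite: LemarieRieusset2016, Thm. 6.1] -/
theorem inner_duhamelDatum_eq {u₀ : E → E} (hu₀ : MemLp u₀ 2 (volume : Measure E)) (ν t : ℝ)
    {v₀ : Lp E 2 (volume : Measure E)}
    (hv₀ : (v₀ : E → E) =ᵐ[volume]
      heatFlow ((lerayProjector E (hu₀.toLp u₀) : Lp E 2 (volume : Measure E)) : E → E) (ν * t))
    (φ : divFreeTest E) :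
    ⟪v₀, divFreeTestToL2 E φ⟫ = ∫ x, ⟪u₀ x, heatTest ν (φ : E → E) t x⟫ := by
  set PU : Lp E 2 (volume : Measure E) := lerayProjector E (hu₀.toLp u₀) with hPU
  have hPUm : MemLp (PU : E → E) 2 volume := Lp.memLp PU
  have hφm : MemLp (φ : E → E) 2 volume := memLp_of_mem_divFreeTest φ.2 2
  -- `⟪v₀, [φ]⟫ = ∫⟪e^{νtΔ}(P u₀), φ⟫ = ∫⟪P u₀, e^{νtΔ}φ⟫`
  have h1 : ⟪v₀, divFreeTestToL2 E φ⟫ = ∫ x, ⟪(PU : E → E) x, heatTest ν (φ : E → E) t x⟫ := by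
    rw [inner_divFreeTestToL2]
    have h2 : ∫ x, ⟪(v₀ : E → E) x, (φ : E → E) x⟫ = ∫ x, ⟪heatFlow (PU : E → E) (ν * t) x, (φ : E → E) x⟫ := by
      refine integral_congr_ae ?_
      filter_upwards [hv₀] with x hx
      rw [hx]
    rw [h2, integral_inner_heatFlow_comm hPUm hφm]
    rfl
  -- `∫⟪P u₀, e^{νtΔ}φ⟫ = ⟪P u₀, [e^{νtΔ}φ]⟫ = ⟪u₀, [e^{νtΔ}φ]⟫ = ∫⟪u₀, e^{νtΔ}φ⟫`
  set Ψ : Lp E 2 (volume : Measure E) := (memLp_heatTest φ.2.1 ν t).toLp (heatTest ν (φ : E → E) t)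
    with hΨ
  have h3 : ∫ x, ⟪(PU : E → E) x, heatTest ν (φ : E → E) t x⟫ = ⟪PU, Ψ⟫ := by
    rw [L2.inner_def]
    refine integral_congr_ae ?_
    filter_upwards [(memLp_heatTest φ.2.1 ν t).coeFn_toLp] with x hx
    rw [hΨ, hx]
  have h4 : ⟪hu₀.toLp u₀, Ψ⟫ = ∫ x, ⟪u₀ x, heatTest ν (φ : E → E) t x⟫ := by
    rw [L2.inner_def]
    refine integral_congr_ae ?_
    filter_upwards [(memLp_heatTest φ.2.1 ν t).coeFn_toLp, hu₀.coeFn_toLp] with x hx hx'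
    rw [hΨ, hx, hx']
  rw [h1, h3, hPU, inner_lerayProjector_toLp_heatTest, h4]

/-! ### The Duhamel integrand: representation, measurability, integrability -/

/-- `heatDivTensor` only depends on the a.e. classes of its arguments. [folklore] -/
theorem heatDivTensor_congr_ae {F : Type*} [NormedAddCommGroup F] [NormedSpace ℝ F] {v v' : E → E}
    {w w' : E → F} (hv : v =ᵐ[volume] v') (hw : w =ᵐ[volume] w') (σ : ℝ) :
    heatDivTensor σ v w = heatDivTensor σ v' w' := by
  funext x
  unfold heatDivTensor
  refine integral_congr_ae ?_
  filter_upwards [hv, hw] with y hy hy'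
  rw [hy, hy']

/-- Bochner integrals in `L²` of Leray-projected integrands lie in `L²_σ` (if the integrand is not
integrable the integral is `0`). [folklore] -/
theorem intervalIntegral_lerayProjector_mem (f : ℝ → Lp E 2 (volume : Measure E)) (a b : ℝ) :
    (∫ τ in a..b, lerayProjector E (f τ)) ∈ solenoidalL2 E := by
  by_cases hf : IntervalIntegrable (fun τ => lerayProjector E (f τ)) volume a b
  · have h := (lerayProjector E).intervalIntegral_comp_comm hf
    have h2 : (fun τ => lerayProjector E (lerayProjector E (f τ))) = fun τ => lerayProjector E (f τ) :=
      funext fun τ => lerayProjector_apply_of_mem (lerayProjector_apply_mem _)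
    rw [h2] at h
    rw [h]
    exact lerayProjector_apply_mem _
  · rw [intervalIntegral.integral_undef hf]
    exact zero_mem _

/-- Outside the endpoint, `Ι 0 t` is `(0, t)` almost everywhere: an everywhere statement on
`Ioo 0 t` holds a.e. on `Ι 0 t`. [folklore] -/
theorem ae_uIoc_of_forall_Ioo {t : ℝ} (ht : 0 ≤ t) {p : ℝ → Prop} (h : ∀ τ ∈ Ioo 0 t, p τ) :
    ∀ᵐ τ ∂(volume : Measure ℝ), τ ∈ Ι 0 t → p τ := by
  have hne : ∀ᵐ τ ∂(volume : Measure ℝ), τ ≠ t := by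
    have : ({t} : Set ℝ)ᶜ ∈ ae (volume : Measure ℝ) := compl_mem_ae_iff.2 (by simp)
    filter_upwards [this] with τ hτ
    simpa using hτ
  filter_upwards [hne] with τ hτ hmem
  rw [uIoc_of_le ht] at hmem
  exact h τ ⟨hmem.1, lt_of_le_of_ne hmem.2 hτ⟩

variable {ν T : ℝ} {u : ℝ → E → E} {u₀ : E → E}

/-- **The Duhamel integrand is a.e. strongly measurable in `L²`.** If `u` is measurable on
`(0, T) × E` and `N : ℝ → L²` represents `τ ↦ e^{ν(t-τ)Δ} div (u ⊗ u)(τ)` on `(0, t)`, `t ≤ T`,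
then `N` is a.e. strongly measurable on `(0, t)`: replace `u` by a jointly measurable version `U`
(equal to `u(τ)` a.e. in space for a.e. `τ`), so that `N(τ)` is for a.e. `τ` the class of the
jointly measurable `heatDivTensor (ν(t-τ)) U(τ) U(τ)` (`aestronglyMeasurable_heatDivTensor_param`),
and apply the `L²`-slice form of Pettis' theorem (`aestronglyMeasurable_of_ae_eq_slice`).
[cite: Pettis1938, Thm. 1.1] -/
theorem aestronglyMeasurable_duhamel_slices {t : ℝ} (ht : t ≤ T)
    (hmeas : AEStronglyMeasurable (uncurry u) (volume.restrict (Ioo 0 T ×ˢ univ)))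
    {N : ℝ → Lp E 2 (volume : Measure E)}
    (hN : ∀ τ ∈ Ioo 0 t, ((N τ : Lp E 2 (volume : Measure E)) : E → E) =ᵐ[volume]
      heatDivTensor (ν * (t - τ)) (u τ) (u τ)) :
    AEStronglyMeasurable N (volume.restrict (Ioo 0 t)) := by
  -- a jointly measurable version of `u`
  have hμ : (volume.restrict (Ioo 0 T ×ˢ (univ : Set E)) : Measure (ℝ × E)) =
      (volume.restrict (Ioo 0 T)).prod (volume : Measure E) := by
    rw [Measure.volume_eq_prod, ← Measure.prod_restrict, Measure.restrict_univ]
  rw [hμ] at hmeas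
  set U : ℝ × E → E := hmeas.mk (uncurry u) with hU
  have hUm : StronglyMeasurable U := hmeas.stronglyMeasurable_mk
  have hslice : ∀ᵐ τ ∂(volume.restrict (Ioo 0 T)), ∀ᵐ x ∂(volume : Measure E), u τ x = U (τ, x) :=
    Measure.ae_ae_of_ae_prod (p := fun z : ℝ × E => uncurry u z = U z) hmeas.ae_eq_mk
  -- the jointly measurable integrand built on `U`
  set G : ℝ × E → E := fun q =>
    heatDivTensor (ν * (t - q.1)) (fun y => U (q.1, y)) (fun y => U (q.1, y)) q.2 with hG
  have hGm : AEStronglyMeasurable G ((volume.restrict (Ioo 0 t)).prod (volume : Measure E)) := by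
    have hc : Measurable fun τ : ℝ => ν * (t - τ) := measurable_const.mul (measurable_const.sub measurable_id)
    exact aestronglyMeasurable_heatDivTensor_param (μ := volume.restrict (Ioo 0 t)) hc
      hUm.aestronglyMeasurable hUm.aestronglyMeasurable
  -- `N τ` is the slice of `G` for a.e. `τ ∈ (0, t)`
  have hN' : ∀ᵐ τ ∂(volume.restrict (Ioo 0 t)),
      ((N τ : Lp E 2 (volume : Measure E)) : E → E) =ᵐ[volume] fun x => G (τ, x) := by
    have h1 : ∀ᵐ τ ∂(volume.restrict (Ioo 0 t)), ∀ᵐ x ∂(volume : Measure E), u τ x = U (τ, x) :=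
      ae_restrict_of_ae_restrict_of_subset (Ioo_subset_Ioo_right ht) hslice
    filter_upwards [h1, ae_restrict_mem measurableSet_Ioo] with τ hτ hτmem
    have h2 : heatDivTensor (ν * (t - τ)) (u τ) (u τ) =
        heatDivTensor (ν * (t - τ)) (fun y => U (τ, y)) (fun y => U (τ, y)) :=
      heatDivTensor_congr_ae hτ hτ _
    filter_upwards [hN τ hτmem] with x hx
    rw [hx, h2]
  exact FunctionSpaces.aestronglyMeasurable_of_ae_eq_slice hGm hN'

/-- **`L²` bound for the Duhamel integrand**: for `τ ∈ (0, t)`, `t < T`, `‖u‖ ≤ C` on `[0,T) × E`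
and `u τ ∈ L²`,
`‖[heatDivTensor (ν(t-τ)) (u τ) (u τ)]‖ ≤ C 2^{n/2} (ν(t-τ))^{-1/2} ‖u τ‖₂` (Young; Kato 1984,
(2.3')). [cite: Kato1984, (1.7)] -/
theorem norm_toLp_heatDivTensor_le (hν : 0 < ν) {C : ℝ} (hC0 : 0 ≤ C)
    (hC : ∀ s ∈ Ico 0 T, ∀ x, ‖u s x‖ ≤ C) {t τ : ℝ} (ht : t < T) (hτ : τ ∈ Ioo 0 t)
    (huτ : MemLp (u τ) 2 (volume : Measure E))
    (hmem : MemLp (heatDivTensor (ν * (t - τ)) (u τ) (u τ)) 2 (volume : Measure E)) :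
    ‖hmem.toLp _‖ ≤ C * ((2 : ℝ) ^ ((Module.finrank ℝ E : ℝ) / 2) * (ν * (t - τ)) ^ (-(1 / 2 : ℝ))) *
      (eLpNorm (u τ) 2 (volume : Measure E)).toReal := by
  have hσ : 0 < ν * (t - τ) := mul_pos hν (sub_pos.2 hτ.2)
  have hτT : τ ∈ Ico 0 T := ⟨hτ.1.le, hτ.2.trans ht⟩
  have hb : ∀ᵐ y ∂(volume : Measure E), ‖u τ y‖ ≤ C := Eventually.of_forall (hC τ hτT)
  have h := eLpNorm_heatDivTensor_le hC0 hb huτ.1 hσ one_le_two ENNReal.ofNat_ne_top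
    (w := u τ) (v := u τ)
  rw [Lp.norm_toLp]
  have hfin : ENNReal.ofReal (C * ((2 : ℝ) ^ ((Module.finrank ℝ E : ℝ) / 2) *
      (ν * (t - τ)) ^ (-(1 / 2 : ℝ)))) * eLpNorm (u τ) 2 volume ≠ ∞ :=
    ENNReal.mul_ne_top ENNReal.ofReal_ne_top huτ.eLpNorm_ne_top
  refine (ENNReal.toReal_mono hfin h).trans_eq ?_
  rw [ENNReal.toReal_mul, ENNReal.toReal_ofReal (by positivity)]

/-- **The Leray-projected Duhamel integrand is Bochner integrable on `(0, t)`** in `L²`, for `u`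
measurable on `(0,T) × E`, bounded by `C` on `[0,T) × E`, with slices in `L²` and
`u ∈ L^∞((0,T); L²)`: a.e. strong measurability (`aestronglyMeasurable_duhamel_slices`) and the
bound `‖P N(τ)‖ ≤ C 2^{n/2} ν^{-1/2} ‖u‖_{L^∞L²} (t-τ)^{-1/2}`, integrable at `τ = t`
(Lemarié-Rieusset 2016, Thm. 6.1; Kato 1984, (2.3')). [cite: LemarieRieusset2016, Thm. 6.1] -/
theorem intervalIntegrable_lerayProjector_duhamel (hν : 0 < ν)
    (hmeas : AEStronglyMeasurable (uncurry u) (volume.restrict (Ioo 0 T ×ˢ univ)))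
    (hu : ∀ s ∈ Ico 0 T, MemLp (u s) 2 (volume : Measure E)) {C : ℝ} (hC0 : 0 ≤ C)
    (hC : ∀ s ∈ Ico 0 T, ∀ x, ‖u s x‖ ≤ C) (hE : MemLqLp ∞ 2 u (Ioo 0 T)) {t : ℝ} (ht : t ∈ Ico 0 T)
    {N : ℝ → Lp E 2 (volume : Measure E)}
    (hN : ∀ τ ∈ Ioo 0 t, ∃ hmem : MemLp (heatDivTensor (ν * (t - τ)) (u τ) (u τ)) 2 (volume : Measure E),
      N τ = hmem.toLp _) :
    IntervalIntegrable (fun τ => lerayProjector E (N τ)) volume 0 t := by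
  have htT : t ≤ T := ht.2.le
  -- representation of `N` as classes
  have hNrep : ∀ τ ∈ Ioo 0 t, ((N τ : Lp E 2 (volume : Measure E)) : E → E) =ᵐ[volume]
      heatDivTensor (ν * (t - τ)) (u τ) (u τ) := fun τ hτ => by
    obtain ⟨hmem, hNτ⟩ := hN τ hτ
    rw [hNτ]
    exact hmem.coeFn_toLp
  have hNm : AEStronglyMeasurable N (volume.restrict (Ioo 0 t)) :=
    aestronglyMeasurable_duhamel_slices htT hmeas hNrep
  -- the measure on `Ι 0 t = Ioc 0 t` agrees with that on `Ioo 0 t`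
  have hI : (volume : Measure ℝ).restrict (Ι 0 t) = volume.restrict (Ioo 0 t) := by
    rw [uIoc_of_le ht.1]
    exact (Measure.restrict_congr_set Ioo_ae_eq_Ioc).symm
  -- the dominating function
  set M : ℝ := (eLqLpNorm ∞ 2 u (Ioo 0 T)).toReal with hM
  set K : ℝ := C * ((2 : ℝ) ^ ((Module.finrank ℝ E : ℝ) / 2) * ν ^ (-(1 / 2 : ℝ))) * M with hK
  have hg : IntervalIntegrable (fun τ => K * (t - τ) ^ (-(1 / 2 : ℝ))) volume 0 t := by
    have h1 := (intervalIntegral.intervalIntegrable_rpow' (a := t) (b := 0)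
      (show (-1 : ℝ) < -(1 / 2 : ℝ) by norm_num)).comp_sub_left t
    simp only [sub_self, sub_zero] at h1
    exact h1.const_mul K
  refine hg.mono_fun' ?_ ?_
  · rw [hI]
    exact (lerayProjector E).continuous.comp_aestronglyMeasurable hNm
  · rw [hI]
    have hbd : ∀ᵐ τ ∂(volume.restrict (Ioo 0 t)), eLpNorm (u τ) 2 volume ≤ eLqLpNorm ∞ 2 u (Ioo 0 T) :=
      ae_restrict_of_ae_restrict_of_subset (Ioo_subset_Ioo_right htT) hE.ae_eLpNorm_le_top
    filter_upwards [hbd, ae_restrict_mem measurableSet_Ioo] with τ hτb hτ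
    obtain ⟨hmem, hNτ⟩ := hN τ hτ
    have hτT : τ ∈ Ico 0 T := ⟨hτ.1.le, hτ.2.trans ht.2⟩
    have hfinT : eLqLpNorm ∞ 2 u (Ioo 0 T) ≠ ∞ := hE.2.ne
    have hM' : (eLpNorm (u τ) 2 volume).toReal ≤ M := ENNReal.toReal_mono hfinT hτb
    have hpos : 0 < t - τ := sub_pos.2 hτ.2
    calc ‖lerayProjector E (N τ)‖ ≤ ‖lerayProjector E‖ * ‖N τ‖ := ContinuousLinearMap.le_opNorm _ _
      _ ≤ 1 * ‖N τ‖ := mul_le_mul_of_nonneg_right lerayProjector_norm_le_one (norm_nonneg _)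
      _ = ‖hmem.toLp _‖ := by rw [one_mul, hNτ]
      _ ≤ C * ((2 : ℝ) ^ ((Module.finrank ℝ E : ℝ) / 2) * (ν * (t - τ)) ^ (-(1 / 2 : ℝ))) *
            (eLpNorm (u τ) 2 (volume : Measure E)).toReal :=
          norm_toLp_heatDivTensor_le hν hC0 hC ht.2 hτ (hu τ hτT) hmem
      _ ≤ C * ((2 : ℝ) ^ ((Module.finrank ℝ E : ℝ) / 2) * (ν * (t - τ)) ^ (-(1 / 2 : ℝ))) * M := by
          gcongr
      _ = K * (t - τ) ^ (-(1 / 2 : ℝ)) := by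
          rw [hK, Real.mul_rpow hν.le hpos.le]
          ring

/-- **Pairing of the Duhamel integral with a test field**: with `N` as above (Bochner integrable
after projection),
`⟪∫₀ᵗ P N(τ) dτ, [φ]⟫ = -∫₀ᵗ ∫ ⟪u τ, (u τ·∇) e^{ν(t-τ)Δ}φ⟫ dτ` for `φ ∈ 𝒱` (the functional
`⟪·, [φ]⟫` passes through the Bochner integral; `P[φ] = [φ]`; the pairing identity
`integral_inner_heatDivTensor_eq`). This is the nonlinear term of the duality formulation
(Fabes–Jones–Rivière 1972, Thm. 2.1; Lemarié-Rieusset 2016, Thm. 6.1). [cite: LemarieRieusset2016, Thm. 6.1] -/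
theorem inner_intervalIntegral_lerayProjector_eq (hν : 0 < ν)
    (hu : ∀ s ∈ Ico 0 T, MemLp (u s) 2 (volume : Measure E)) {C : ℝ}
    (hC : ∀ s ∈ Ico 0 T, ∀ x, ‖u s x‖ ≤ C) {t : ℝ} (ht : t ∈ Ico 0 T)
    {N : ℝ → Lp E 2 (volume : Measure E)}
    (hNrep : ∀ τ ∈ Ioo 0 t, ((N τ : Lp E 2 (volume : Measure E)) : E → E) =ᵐ[volume]
      heatDivTensor (ν * (t - τ)) (u τ) (u τ))
    (hInt : IntervalIntegrable (fun τ => lerayProjector E (N τ)) volume 0 t) (φ : divFreeTest E) :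
    ⟪∫ τ in (0 : ℝ)..t, lerayProjector E (N τ), divFreeTestToL2 E φ⟫ =
      -∫ τ in (0 : ℝ)..t, ∫ x, ⟪u τ x, convect (u τ) (heatTest ν (φ : E → E) (t - τ)) x⟫ := by
  set Φ : Lp E 2 (volume : Measure E) := divFreeTestToL2 E φ with hΦ
  have hφm : MemLp (φ : E → E) 2 volume := memLp_of_mem_divFreeTest φ.2 2
  -- pass `⟪Φ, ·⟫` through the Bochner integral
  have h1 : ⟪∫ τ in (0 : ℝ)..t, lerayProjector E (N τ), Φ⟫ =
      ∫ τ in (0 : ℝ)..t, ⟪Φ, lerayProjector E (N τ)⟫ := by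
    rw [real_inner_comm]
    have h := ((innerSL ℝ Φ).intervalIntegral_comp_comm hInt).symm
    simpa only [innerSL_apply_apply] using h
  rw [h1, ← intervalIntegral.integral_neg]
  refine intervalIntegral.integral_congr_ae (ae_uIoc_of_forall_Ioo ht.1 fun τ hτ => ?_)
  have hτT : τ ∈ Ico 0 T := ⟨hτ.1.le, hτ.2.trans ht.2⟩
  have hσ : 0 < ν * (t - τ) := mul_pos hν (sub_pos.2 hτ.2)
  -- `⟪Φ, P N τ⟫ = ⟪P Φ, N τ⟫ = ⟪Φ, N τ⟫ = ∫ ⟪φ, heatDivTensor …⟫`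
  have h2 : ⟪Φ, lerayProjector E (N τ)⟫ = ⟪Φ, N τ⟫ := by
    change ⟪Φ, (solenoidalL2 E).starProjection (N τ)⟫ = _
    rw [← Submodule.inner_starProjection_left_eq_right]
    change ⟪lerayProjector E Φ, N τ⟫ = _
    rw [lerayProjector_apply_of_mem (divFreeTestToL2_mem φ)]
  have h3 : ⟪Φ, N τ⟫ = ∫ x, ⟪heatDivTensor (ν * (t - τ)) (u τ) (u τ) x, (φ : E → E) x⟫ := by
    rw [hΦ, inner_divFreeTestToL2_left]
    refine integral_congr_ae ?_
    filter_upwards [hNrep τ hτ] with x hx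
    rw [hx, real_inner_comm]
  have hb : ∀ᵐ y ∂(volume : Measure E), ‖u τ y‖ ≤ C := Eventually.of_forall (hC τ hτT)
  rw [h2, h3, integral_inner_heatDivTensor_eq (hu τ hτT).1 hb (hu τ hτT) hφm hσ,
    ← heatTest_of_pos hν (sub_pos.2 hτ.2) (φ : E → E)]
  rfl

/-- **The canonical Duhamel data at time `t`.** Under the hypotheses of
`isMildNSSolutionOn_iff_duhamel_two`, for every `t ∈ [0, T)` there are `v₀ = [e^{νtΔ} P u₀]` and
`N(τ) = [e^{ν(t-τ)Δ} div (u ⊗ u)(τ)]` (`τ ∈ (0,t)`) in `L²` such that `P N` is Bochner integrable on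
`(0, t)`, `v₀ - ∫₀ᵗ P N ∈ L²_σ`, and for every `φ ∈ 𝒱`
`⟪v₀ - ∫₀ᵗ P N, [φ]⟫ = ∫⟪u₀, e^{νtΔ}φ⟫ + ∫₀ᵗ ∫ ⟪u, (u·∇) e^{ν(t-τ)Δ}φ⟫` — the right-hand side of
the duality identity (Lemarié-Rieusset 2016, Thm. 6.1: the integral formulation tested against
divergence-free fields). [cite: LemarieRieusset2016, Thm. 6.1] -/
theorem exists_duhamel_data (hν : 0 < ν) (hu₀ : MemLp u₀ 2 (volume : Measure E))
    (hmeas : AEStronglyMeasurable (uncurry u) (volume.restrict (Ioo 0 T ×ˢ univ)))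
    (hu : ∀ s ∈ Ico 0 T, MemLp (u s) 2 (volume : Measure E)) {C : ℝ} (hC0 : 0 ≤ C)
    (hC : ∀ s ∈ Ico 0 T, ∀ x, ‖u s x‖ ≤ C) (hE : MemLqLp ∞ 2 u (Ioo 0 T)) {t : ℝ} (ht : t ∈ Ico 0 T) :
    ∃ (v₀ : Lp E 2 (volume : Measure E)) (N : ℝ → Lp E 2 (volume : Measure E)),
      ((v₀ : E → E) =ᵐ[volume]
        heatFlow ((lerayProjector E (hu₀.toLp u₀) : Lp E 2 (volume : Measure E)) : E → E) (ν * t)) ∧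
      (∀ τ ∈ Ioo 0 t, ((N τ : Lp E 2 (volume : Measure E)) : E → E) =ᵐ[volume]
        heatDivTensor (ν * (t - τ)) (u τ) (u τ)) ∧
      IntervalIntegrable (fun τ => lerayProjector E (N τ)) volume 0 t ∧
      (v₀ - ∫ τ in (0 : ℝ)..t, lerayProjector E (N τ)) ∈ solenoidalL2 E ∧
      ∀ φ : divFreeTest E,
        ⟪v₀ - ∫ τ in (0 : ℝ)..t, lerayProjector E (N τ), divFreeTestToL2 E φ⟫ =
          (∫ x, ⟪u₀ x, heatTest ν (φ : E → E) t x⟫) +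
            ∫ τ in (0 : ℝ)..t, ∫ x, ⟪u τ x, convect (u τ) (heatTest ν (φ : E → E) (t - τ)) x⟫ := by
  classical
  set PU : Lp E 2 (volume : Measure E) := lerayProjector E (hu₀.toLp u₀) with hPU
  -- the datum term
  have hV₀m : MemLp (heatFlow (PU : E → E) (ν * t)) 2 (volume : Measure E) :=
    memLp_heatFlow_of_memLp (Lp.memLp PU) one_le_two _
  set v₀ : Lp E 2 (volume : Measure E) := hV₀m.toLp _ with hv₀
  have hv₀ae : (v₀ : E → E) =ᵐ[volume] heatFlow (PU : E → E) (ν * t) := hV₀m.coeFn_toLp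
  -- the Duhamel integrand
  set N : ℝ → Lp E 2 (volume : Measure E) := fun τ =>
    if h : MemLp (heatDivTensor (ν * (t - τ)) (u τ) (u τ)) 2 (volume : Measure E) then h.toLp _ else 0
    with hNdef
  have hmemN : ∀ τ ∈ Ioo 0 t, MemLp (heatDivTensor (ν * (t - τ)) (u τ) (u τ)) 2 (volume : Measure E) :=
    fun τ hτ => by
    have hτT : τ ∈ Ico 0 T := ⟨hτ.1.le, hτ.2.trans ht.2⟩
    exact memLp_heatDivTensor (hu τ hτT).1 (Eventually.of_forall (hC τ hτT)) (hu τ hτT)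
      (mul_pos hν (sub_pos.2 hτ.2)) one_le_two ENNReal.ofNat_ne_top
  have hN : ∀ τ ∈ Ioo 0 t, ∃ hmem : MemLp (heatDivTensor (ν * (t - τ)) (u τ) (u τ)) 2 (volume : Measure E),
      N τ = hmem.toLp _ := fun τ hτ => ⟨hmemN τ hτ, by rw [hNdef]; exact dif_pos (hmemN τ hτ)⟩
  have hNrep : ∀ τ ∈ Ioo 0 t, ((N τ : Lp E 2 (volume : Measure E)) : E → E) =ᵐ[volume]
      heatDivTensor (ν * (t - τ)) (u τ) (u τ) := fun τ hτ => by
    obtain ⟨hmem, hNτ⟩ := hN τ hτ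
    rw [hNτ]
    exact hmem.coeFn_toLp
  have hInt : IntervalIntegrable (fun τ => lerayProjector E (N τ)) volume 0 t :=
    intervalIntegrable_lerayProjector_duhamel hν hmeas hu hC0 hC hE ht hN
  -- membership in `L²_σ`
  have hv₀mem : v₀ ∈ solenoidalL2 E := by
    refine (mem_solenoidalL2_iff_holds _).2 ?_
    have hdiv : IsWeaklyDivFree (PU : E → E) := isWeaklyDivFree_of_mem_solenoidalL2 (lerayProjector_apply_mem _)
    exact (hdiv.heatFlow_of_memLp one_le_two (Lp.memLp PU) (ν * t)).congr_ae hv₀ae.symm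
  have hDmem := intervalIntegral_lerayProjector_mem (E := E) N 0 t
  refine ⟨v₀, N, hv₀ae, hNrep, hInt, sub_mem hv₀mem hDmem, fun φ => ?_⟩
  rw [inner_sub_left, inner_duhamelDatum_eq hu₀ ν t hv₀ae φ,
    inner_intervalIntegral_lerayProjector_eq hν hu hC ht hNrep hInt φ, sub_neg_eq_add]

/-! ### The discharge -/

/-- **Duality form ⇔ semigroup Duhamel formula in `L²`** — discharge of the named fact
`isMildNSSolutionOn_iff_duhamel_two` (Lemarié-Rieusset 2002, Thm. 11.2 = Lemarié-Rieusset 2016,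
Thm. 6.1; Kato 1984, (1.7); Fabes–Jones–Rivière 1972, Thm. 2.1): for `0 < ν`, `u₀ ∈ L²`, `u`
measurable on `(0,T) × E`, bounded on `[0,T) × E`, with slices in `L²` and `u ∈ L^∞((0,T); L²)`,
`u` is an unforced mild solution on `[0, T)` in duality form iff, for every `t ∈ [0,T)`,
`u(t) = e^{νtΔ} P u₀ - ∫₀ᵗ P e^{ν(t-τ)Δ} div (u ⊗ u)(τ) dτ` in `L²(E; E)`. See the module docstring
for the proof. [cite: LemarieRieusset2002, Thm. 11.2] -/
theorem isMildNSSolutionOn_iff_duhamel_two_holds :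
    isMildNSSolutionOn_iff_duhamel_two (ν := ν) (T := T) (u := u) (u₀ := u₀) := by
  intro hν hu₀ hmeas hu hb hE
  obtain ⟨C₀, hC₀⟩ := hb
  -- a nonnegative bound
  set C : ℝ := max C₀ 0 with hCdef
  have hC0 : 0 ≤ C := le_max_right _ _
  have hC : ∀ s ∈ Ico 0 T, ∀ x, ‖u s x‖ ≤ C := fun s hs x => (hC₀ s hs x).trans (le_max_left _ _)
  constructor
  · -- (⇒): the duality form implies the Duhamel formula
    intro h t ht
    obtain ⟨v₀, N, hv₀, hN, hInt, hmem, hpair⟩ := exists_duhamel_data hν hu₀ hmeas hu hC0 hC hE ht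
    refine ⟨v₀, N, hv₀, hN, ?_⟩
    set w : Lp E 2 (volume : Measure E) :=
      (hu t ht).toLp (u t) - (v₀ - ∫ τ in (0 : ℝ)..t, lerayProjector E (N τ)) with hw
    -- `[u t] ∈ L²_σ`
    have hut : (hu t ht).toLp (u t) ∈ solenoidalL2 E :=
      (mem_solenoidalL2_iff_holds _).2 ((h.1 t ht).congr_ae (hu t ht).coeFn_toLp.symm)
    have hwmem : w ∈ solenoidalL2 E := sub_mem hut hmem
    have hwdiv : IsWeaklyDivFree ((w : Lp E 2 (volume : Measure E)) : E → E) :=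
      isWeaklyDivFree_of_mem_solenoidalL2 hwmem
    -- `w` annihilates `𝒱`
    have hworth : ∀ φ : E → E, FunctionSpaces.IsTestFunctionOn (⊤ : Opens E) φ →
        VectorCalculus.IsDivFree φ → ∫ x, ⟪(w : E → E) x, φ x⟫ = 0 := fun φ hφ hdiv => by
      -- the duality identity at `t`, stated through the element `⟨φ, _⟩ ∈ 𝒱`
      have hid := h.2 t ht (((⟨φ, hφ, hdiv⟩ : divFreeTest E) : divFreeTest E) : E → E) hφ hdiv
      simp only [Pi.zero_apply, inner_zero_left, integral_zero, intervalIntegral.integral_zero,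
        add_zero] at hid
      show ∫ x, ⟪(w : E → E) x, (((⟨φ, hφ, hdiv⟩ : divFreeTest E) : divFreeTest E) : E → E) x⟫ = 0
      rw [← inner_divFreeTestToL2 w ⟨φ, hφ, hdiv⟩, hw, inner_sub_left, hpair ⟨φ, hφ, hdiv⟩,
        inner_toLp_divFreeTestToL2, hid, sub_self]
    have hae := IsWeaklyDivFree.ae_eq_zero_of_memLp_of_forall_integral_inner_eq_zero
      ENNReal.one_lt_two ENNReal.ofNat_lt_top (Lp.memLp w) hwdiv hworth
    have hw0 : w = 0 := (Lp.eq_zero_iff_ae_eq_zero).2 hae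
    rw [hw, sub_eq_zero] at hw0
    exact hw0
  · -- (⇐): the Duhamel formula implies the duality form
    intro h
    -- at each time, the given data are the canonical ones
    have key : ∀ t (ht : t ∈ Ico 0 T), (hu t ht).toLp (u t) ∈ solenoidalL2 E ∧
        ∀ φ : divFreeTest E, ⟪(hu t ht).toLp (u t), divFreeTestToL2 E φ⟫ =
          (∫ x, ⟪u₀ x, heatTest ν (φ : E → E) t x⟫) +
            ∫ τ in (0 : ℝ)..t, ∫ x, ⟪u τ x, convect (u τ) (heatTest ν (φ : E → E) (t - τ)) x⟫ := by
      intro t ht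
      obtain ⟨v₀, N, hv₀, hN, hInt, hmem, hpair⟩ := exists_duhamel_data hν hu₀ hmeas hu hC0 hC hE ht
      obtain ⟨v₀', N', hv₀', hN', hEq⟩ := h t ht
      have hv : v₀' = v₀ := Lp.ext (hv₀'.trans hv₀.symm)
      have hD : ∫ τ in (0 : ℝ)..t, lerayProjector E (N' τ) = ∫ τ in (0 : ℝ)..t, lerayProjector E (N τ) := by
        refine intervalIntegral.integral_congr_ae (ae_uIoc_of_forall_Ioo ht.1 fun τ hτ => ?_)
        rw [Lp.ext ((hN' τ hτ).trans (hN τ hτ).symm)]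
      rw [hv, hD] at hEq
      rw [hEq]
      exact ⟨hmem, hpair⟩
    refine ⟨fun t ht => ?_, fun t ht φ hφ hdiv => ?_⟩
    · exact (isWeaklyDivFree_of_mem_solenoidalL2 (key t ht).1).congr_ae (hu t ht).coeFn_toLp
    · have hid := (key t ht).2 ⟨φ, hφ, hdiv⟩
      rw [inner_toLp_divFreeTestToL2] at hid
      simp only [Pi.zero_apply, inner_zero_left, integral_zero, intervalIntegral.integral_zero,
        add_zero]
      exact hid

end Literature.Analysis.FluidPDE
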